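import Literature.Probability.Percolation.SeededCollar
import HarnessLib

/-!
# The structure theorem of the glued configuration: open crossings are chains of hubs linked through the accessible fresh region

Topic `Probability/Percolation`.  Part of the formalisation of Schramm–Smirnov's mesh-independent
gluing for critical bond percolation on `ℤ²` (O. Schramm, S. Smirnov, *On the scaling limits of
planar percolation*, Ann. Probab. 39 (2011), arXiv:1101.5820, §4, proof of Prop. 4.1, steps
"Describing the crossing structure by a finite graph": "Clearly, `ω̃ ∈ ⊞_{Q₀}` if and only if there
is a path from `∂₀Q₀` … to `∂₂Q₀` in `G ∪ G*`", where `G` records the connectivity of the explored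
open clusters inside the explored set `M` and `G*` their connectivity through the fresh region
`[Q₀] ∖ M`).

Lattice-native rendition.  The sites of `ℤ²` are split into four ZONES (`Seeded.Zones`): the
collar `K` (explored by the seeded boundary-interface exploration `SeededExplorer.lean` of the
collar datum `(K, Far)`, `SeededCollar.lean`), the fresh tubes `N` around the cut `α`, the excised
squares `SQ` (all their edges are declared closed), and the far side `Far` (everything else,
explored wholesale; its sites are the seeds of `𝒪`).  Given terminal exploration data `X` of a
configuration `ω`:

* `Zones.tubeEdges` — the lattice edges with an endpoint in `N` and none in `SQ`;
  `Zones.fresh X = (A ∖ X) ∪ tubeEdges` — the edges whose state is not read by the exploration;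
* `Zones.Acc X ω e` — **the accessible fresh region**: fresh edges joined to a tube edge by a chain
  of fresh edges, consecutive ones sharing a site NOT in `𝒪` (a fresh open path stops — docks — when
  it reaches the explored open world `𝒪`); the complement of `Acc` is what is conditioned upon
  (pockets of fresh edges not accessible from the tubes are revealed too: they touch `Acc` only at
  sites of `𝒪`, `Zones.oReach_of_acc_of_not_acc`);
* `Zones.junction` — **junction lemma**: along an `η`-open path (`η` any configuration agreeing with
  `ω` on `X` and closed on the edges of the squares), an accessible edge and a non-accessible edge
  can only meet at a site of `𝒪` (examined open edges have their endpoints in `𝒪`; pockets extend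
  `Acc` through non-`𝒪` sites; an edge neither examinable nor a tube edge at a site off `Far` touches
  a square);
* `Zones.Link` — two sites of `𝒪` joined either by an `η`-open path of NON-accessible (revealed)
  edges (an edge of Schramm–Smirnov's `G`) or by an `η`-open path of accessible edges (an edge of
  `G*`), inside a region `U`;
* **`Zones.reflTransGen_link_of_walk`**, **`Zones.exists_walk_of_reflTransGen_link`** — an `η`-open
  walk inside `U` between sites of `𝒪` is a chain of links, and conversely: **the crossing event is
  a connectivity event of the finite graph `G ∪ G*`** (`Zones.exists_walk_iff_reflTransGen_link`).

* `Zones.revealed G₀ ω` — the edges of the window `G₀` off the accessible region of the terminal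
  data of `ω`; it contains the examined edges, its complement in `G₀` is exactly the accessible
  region (`mem_sdiff_revealed_iff`), and **it is a stopping set** (`Zones.isStoppingSet_revealed`:
  "`M(ω₂) = M(ω)`"), so that `StoppingSetCondExp.lean` applies to `Ỹ = P(· | revealed data)`.

Everything is proved; no named fact is introduced.

## References

* O. Schramm, S. Smirnov, Ann. Probab. 39 (2011) 1768–1814, arXiv:1101.5820, §4, proof of
  Prop. 4.1 ("Describing the crossing structure by a finite graph"). [SchrammSmirnov2011]
* G. Grimmett, *Percolation*, 2nd ed. (1999), §1.3 (open paths and clusters). [GrimmettPercolation1999]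
-/

noncomputable section

open SimpleGraph

namespace Literature.Probability.Percolation

open LatticeModels Relation
open scoped Classical

namespace Seeded

/-! ### Zones -/

/-- **The four zones of the gluing construction**: collar sites `K`, tube sites `N`, square sites
`SQ` (pairwise disjoint finite sets); every other site is FAR.
[cite: SchrammSmirnov2011, §4, proof of Prop. 4.1 ("Setup for the neighborhood of α")] -/
structure Zones where
  /-- the collar (explored by interfaces) -/
  K : Finset (Site 2)
  /-- the fresh tubes around the cut -/
  N : Finset (Site 2)
  /-- the excised squares (all their edges closed) -/
  SQ : Finset (Site 2)
  disjoint_K_N : Disjoint K N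
  disjoint_K_SQ : Disjoint K SQ
  disjoint_N_SQ : Disjoint N SQ

namespace Zones

variable (𝒵 : Zones)

/-- The far sites: everything outside `K ∪ N ∪ SQ`. [cite: SchrammSmirnov2011, §4, proof of Prop. 4.1 (the set M contains the complement of the s-neighbourhood of α)] -/
def Far : Set (Site 2) := {v | v ∉ 𝒵.K ∧ v ∉ 𝒵.N ∧ v ∉ 𝒵.SQ}

/-- The collar datum `(K, Far)` of the zones. [folklore] -/
def collar : CollarDatum where
  K := 𝒵.K
  Far := 𝒵.Far
  disjoint := fun _ hv hF => hF.1 hv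

/-- The seeds of the collar exploration of the zones. [folklore] -/
abbrev seeds : Seeds := 𝒵.collar.seeds

/-- The strip of the collar datum of the zones. [folklore] -/
@[simp] theorem collar_K : 𝒵.collar.K = 𝒵.K := rfl
/-- The far side of the collar datum of the zones. [folklore] -/
@[simp] theorem collar_Far : 𝒵.collar.Far = 𝒵.Far := rfl

/-- **Tube edges**: lattice edges with an endpoint in `N` and no endpoint in `SQ` (tube–tube,
tube–collar legs). [cite: SchrammSmirnov2011, §4, proof of Prop. 4.1 (the component of [Q₀]∖β' containing α)] -/
def tubeEdges : Finset (Sym2 (Site 2)) :=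
  (𝒵.N.biUnion latticeEdgesAt).filter fun e => ∀ v ∈ e, v ∉ 𝒵.SQ

/-- **Square edges**: lattice edges with an endpoint in `SQ` (declared closed). [cite: SchrammSmirnov2011, §4, proof of Prop. 4.1 (the modified configuration ω̃)] -/
def sqEdges : Set (Sym2 (Site 2)) := {e | ∃ v ∈ e, v ∈ 𝒵.SQ}

/-- Membership in the tube edges. [folklore] -/
theorem mem_tubeEdges_iff {e : Sym2 (Site 2)} :
    e ∈ 𝒵.tubeEdges ↔ e ∈ (zdGraph 2).edgeSet ∧ (∃ v ∈ e, v ∈ 𝒵.N) ∧ ∀ v ∈ e, v ∉ 𝒵.SQ := by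
  rw [tubeEdges, Finset.mem_filter, Finset.mem_biUnion]
  constructor
  · rintro ⟨⟨v, hvN, he⟩, hall⟩
    exact ⟨mem_edgeSet_of_mem_latticeEdgesAt he, ⟨v, mem_of_mem_latticeEdgesAt he, hvN⟩, hall⟩
  · rintro ⟨he, ⟨v, hve, hvN⟩, hall⟩
    exact ⟨⟨v, hvN, mem_latticeEdgesAt_of_mem he hve⟩, hall⟩

/-- Tube edges are not examinable (they have an endpoint in `N`, off `K ∪ Far`). [folklore] -/
theorem not_mem_A_of_mem_tubeEdges {e : Sym2 (Site 2)} (he : e ∈ 𝒵.tubeEdges) : e ∉ 𝒵.collar.A := by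
  obtain ⟨-, ⟨v, hve, hvN⟩, -⟩ := 𝒵.mem_tubeEdges_iff.1 he
  exact 𝒵.collar.not_mem_A_of_not_mem hve (fun hK => Finset.disjoint_left.1 𝒵.disjoint_K_N hK hvN)
    (fun hF => hF.2.1 hvN)

/-- **Fresh edges** of terminal data `X`: unexamined examinable edges and tube edges.
[cite: SchrammSmirnov2011, §4, proof of Prop. 4.1 (the complement M' of the explored set)] -/
def fresh (X : Finset (Sym2 (Site 2))) : Finset (Sym2 (Site 2)) := (𝒵.collar.A \ X) ∪ 𝒵.tubeEdges

/-- Membership in the fresh edges. [folklore] -/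
theorem mem_fresh_iff {X : Finset (Sym2 (Site 2))} {e : Sym2 (Site 2)} :
    e ∈ 𝒵.fresh X ↔ (e ∈ 𝒵.collar.A ∧ e ∉ X) ∨ e ∈ 𝒵.tubeEdges := by
  rw [fresh, Finset.mem_union, Finset.mem_sdiff]

/-- Fresh edges are unexamined. [folklore] -/
theorem not_mem_of_mem_fresh {X : Finset (Sym2 (Site 2))} (hX : X ⊆ 𝒵.collar.A) {e : Sym2 (Site 2)}
    (he : e ∈ 𝒵.fresh X) : e ∉ X := by
  rcases 𝒵.mem_fresh_iff.1 he with h | h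
  · exact h.2
  · exact fun heX => 𝒵.not_mem_A_of_mem_tubeEdges h (hX heX)

/-- Fresh edges are lattice edges. [folklore] -/
theorem mem_edgeSet_of_mem_fresh {X : Finset (Sym2 (Site 2))} {e : Sym2 (Site 2)} (he : e ∈ 𝒵.fresh X) :
    e ∈ (zdGraph 2).edgeSet := by
  rcases 𝒵.mem_fresh_iff.1 he with h | h
  · exact (𝒵.collar.mem_A_iff.1 h.1).1
  · exact (𝒵.mem_tubeEdges_iff.1 h).1

/-- Fresh edges do not touch the squares. [folklore] -/
theorem not_mem_sqEdges_of_mem_fresh {X : Finset (Sym2 (Site 2))} {e : Sym2 (Site 2)} (he : e ∈ 𝒵.fresh X) :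
    e ∉ 𝒵.sqEdges := by
  rintro ⟨v, hve, hvSQ⟩
  rcases 𝒵.mem_fresh_iff.1 he with h | h
  · rcases 𝒵.collar.mem_or_mem_of_mem_A h.1 hve with hK | hF
    · exact Finset.disjoint_left.1 𝒵.disjoint_K_SQ hK hvSQ
    · exact hF.2.2 hvSQ
  · exact (𝒵.mem_tubeEdges_iff.1 h).2.2 v hve hvSQ

/-! ### The accessible fresh region -/

variable {𝒵}

section Acc

variable (𝒵) (X : Finset (Sym2 (Site 2))) (ω : BondConfig (Site 2))

/-- One step of accessibility: from a fresh edge to a fresh edge sharing a site not in `𝒪`.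
[cite: SchrammSmirnov2011, §4, proof of Prop. 4.1 (the fresh region: a path docks when it meets a beach)] -/
def AccStep (e e' : Sym2 (Site 2)) : Prop :=
  e' ∈ 𝒵.fresh X ∧ ∃ v, v ∈ e ∧ v ∈ e' ∧ ¬ OReach 𝒵.seeds X ω v

/-- **The accessible fresh region**: fresh edges reached from a tube edge by steps through
non-`𝒪` sites. [cite: SchrammSmirnov2011, §4, proof of Prop. 4.1 (M' = the component of [Q₀]∖β' containing α together with the bays)] -/
def Acc (e : Sym2 (Site 2)) : Prop := ∃ e₀ ∈ 𝒵.tubeEdges, ReflTransGen (𝒵.AccStep X ω) e₀ e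

variable {𝒵 X ω}

/-- Tube edges are accessible. [folklore] -/
theorem acc_of_mem_tubeEdges {e : Sym2 (Site 2)} (he : e ∈ 𝒵.tubeEdges) : 𝒵.Acc X ω e :=
  ⟨e, he, ReflTransGen.refl⟩

/-- Accessibility propagates through non-`𝒪` sites to fresh edges. [folklore] -/
theorem Acc.step {e e' : Sym2 (Site 2)} (he : 𝒵.Acc X ω e) (he' : e' ∈ 𝒵.fresh X) {v : Site 2}
    (hv : v ∈ e) (hv' : v ∈ e') (hO : ¬ OReach 𝒵.seeds X ω v) : 𝒵.Acc X ω e' := by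
  obtain ⟨e₀, he₀, h⟩ := he
  exact ⟨e₀, he₀, h.tail ⟨he', v, hv, hv', hO⟩⟩

/-- Accessible edges are fresh. [folklore] -/
theorem Acc.mem_fresh {e : Sym2 (Site 2)} (he : 𝒵.Acc X ω e) : e ∈ 𝒵.fresh X := by
  obtain ⟨e₀, he₀, h⟩ := he
  induction h with
  | refl => exact 𝒵.mem_fresh_iff.2 (Or.inr he₀)
  | tail _ hst _ => exact hst.1

/-- **Pockets touch the accessible region only at `𝒪`**: a fresh, non-accessible edge sharing a
site with an accessible edge shares a site of `𝒪`. [folklore] -/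
theorem oReach_of_acc_of_not_acc {e e' : Sym2 (Site 2)} (he : 𝒵.Acc X ω e) (he' : e' ∈ 𝒵.fresh X)
    (hne' : ¬ 𝒵.Acc X ω e') {v : Site 2} (hv : v ∈ e) (hv' : v ∈ e') : OReach 𝒵.seeds X ω v := by
  by_contra hO
  exact hne' (he.step he' hv hv' hO)

/-- `Acc` only reads `ω` on `X`. [folklore] -/
theorem acc_congr {ω' : BondConfig (Site 2)} (h : ∀ e ∈ X, (e ∈ ω ↔ e ∈ ω')) (e : Sym2 (Site 2)) :
    𝒵.Acc X ω e ↔ 𝒵.Acc X ω' e := by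
  unfold Acc
  refine exists_congr fun e₀ => and_congr_right fun _ => ?_
  have key : ∀ a b, 𝒵.AccStep X ω a b ↔ 𝒵.AccStep X ω' a b := fun a b => by
    unfold AccStep; simp only [oReach_congr h]
  constructor
  · exact fun hr => reflTransGen_of_imp (fun a b hab => (key a b).1 hab) hr
  · exact fun hr => reflTransGen_of_imp (fun a b hab => (key a b).2 hab) hr

end Acc

/-! ### The junction lemma -/

section Junction

variable {X : Finset (Sym2 (Site 2))} {ω η : BondConfig (Site 2)} (hT : IsTerminal 𝒵.seeds X ω)
  (hηX : ∀ e ∈ X, (e ∈ ω ↔ e ∈ η)) (hηSQ : ∀ e ∈ 𝒵.sqEdges, e ∉ η)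
include hT hηX hηSQ

/-- **Junction lemma.**  Let `η` agree with `ω` on the examined edges and be closed on the square
edges.  If an `η`-open lattice edge `e` and an accessible `η`-open edge `e'` share a site `v`, then
`v ∈ 𝒪` or `e` is accessible too.  (Cases: `e` examined — then examined-open, so its endpoints are in
`𝒪`; `e` fresh — then accessibility extends through `v` unless `v ∈ 𝒪`; `e` neither — then `v` is a
far site, a seed of `𝒪`, for otherwise `e` would be a tube edge, examinable, or a square edge.)
[cite: SchrammSmirnov2011, §4, proof of Prop. 4.1 ("a path from ∂₀Q₀ to ∂₂Q₀ in G ∪ G*")] -/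
theorem junction {e e' : Sym2 (Site 2)} (he : e ∈ (zdGraph 2).edgeSet) (heη : e ∈ η)
    (he' : 𝒵.Acc X ω e') {v : Site 2} (hv : v ∈ e) (hv' : v ∈ e') :
    OReach 𝒵.seeds X ω v ∨ 𝒵.Acc X ω e := by
  by_cases heX : e ∈ X
  · -- examined, hence examined-open: endpoints in `𝒪`
    exact Or.inl (hT.oReach_of_mem heX ((hηX e heX).2 heη) hv)
  by_cases hef : e ∈ 𝒵.fresh X
  · -- fresh: accessibility extends unless `v ∈ 𝒪`
    by_cases hO : OReach 𝒵.seeds X ω v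
    · exact Or.inl hO
    · exact Or.inr (he'.step hef hv' hv hO)
  · -- neither examinable nor a tube edge: `v` is far
    left
    have heA : e ∉ 𝒵.collar.A := fun h => hef (𝒵.mem_fresh_iff.2 (Or.inl ⟨h, heX⟩))
    have heT : e ∉ 𝒵.tubeEdges := fun h => hef (𝒵.mem_fresh_iff.2 (Or.inr h))
    have heSQ : ∀ u ∈ e, u ∉ 𝒵.SQ := fun u hu huSQ => hηSQ e ⟨u, hu, huSQ⟩ heη
    have hvN : v ∉ 𝒵.N := fun hvN => heT (𝒵.mem_tubeEdges_iff.2 ⟨he, ⟨v, hv, hvN⟩, heSQ⟩)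
    have hvK : v ∉ 𝒵.K := by
      intro hvK
      -- every endpoint of `e` lies in `K ∪ Far`, so `e ∈ A`
      refine heA (𝒵.collar.mem_A_iff.2 ⟨he, ⟨v, hv, hvK⟩, fun u hu => ?_⟩)
      by_cases huK : u ∈ 𝒵.K
      · exact Or.inl huK
      · right
        refine ⟨huK, fun huN => heT (𝒵.mem_tubeEdges_iff.2 ⟨he, ⟨u, hu, huN⟩, heSQ⟩), heSQ u hu⟩
    have hvF : v ∈ 𝒵.Far := ⟨hvK, hvN, heSQ v hv⟩
    exact oReach_of_mem_seeds (𝔖 := 𝒵.seeds) X ω hvF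

/-- Two `η`-open lattice edges sharing a site not in `𝒪` are both accessible or both not.
[folklore] -/
theorem acc_iff_acc_of_shared {e f : Sym2 (Site 2)} (he : e ∈ (zdGraph 2).edgeSet) (heη : e ∈ η)
    (hf : f ∈ (zdGraph 2).edgeSet) (hfη : f ∈ η) {v : Site 2} (hve : v ∈ e) (hvf : v ∈ f)
    (hv : ¬ OReach 𝒵.seeds X ω v) : 𝒵.Acc X ω e ↔ 𝒵.Acc X ω f :=
  ⟨fun h => (junction hT hηX hηSQ hf hfη h hvf hve).resolve_left hv,
    fun h => (junction hT hηX hηSQ he heη h hve hvf).resolve_left hv⟩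

omit hT hηX hηSQ in
/-- A walk of positive length has a first edge, which contains its start. [folklore] -/
theorem exists_mem_edges_start {w x : Site 2} : ∀ (W : (zdGraph 2).Walk w x), 0 < W.length →
    ∃ f ∈ W.edges, w ∈ f
  | Walk.nil, h => by simp at h
  | Walk.cons' _ y _ _ _, _ => ⟨s(w, y), by simp, Sym2.mem_mk_left _ _⟩

/-- **Monochromatic segments.**  Let `S` be a walk from `u` whose sites after `u` are not in `𝒪`,
followed by one more step `a → a'`, all edges `η`-open.  Then any two edges of this walk are both
accessible or both not. [cite: SchrammSmirnov2011, §4, proof of Prop. 4.1] -/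
theorem acc_iff_acc_of_segment : ∀ {u a a' : Site 2} (S : (zdGraph 2).Walk u a) (h : (zdGraph 2).Adj a a'),
    (∀ z ∈ S.support.tail, ¬ OReach 𝒵.seeds X ω z) → (∀ e ∈ (S.concat h).edges, e ∈ η) →
    ∀ e ∈ (S.concat h).edges, ∀ e' ∈ (S.concat h).edges, (𝒵.Acc X ω e ↔ 𝒵.Acc X ω e')
  | _, _, _, Walk.nil, h, _, _ => by
    intro e he e' he'
    simp only [Walk.concat_nil, Walk.edges_cons, Walk.edges_nil, List.mem_singleton] at he he'
    rw [he, he']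
  | u, a, a', Walk.cons' _ w _ huw S₁, h, hS, hη => by
    rw [Walk.concat_cons] at hη ⊢
    have hwO : ¬ OReach 𝒵.seeds X ω w := hS w (by simp)
    have hS₁ : ∀ z ∈ S₁.support.tail, ¬ OReach 𝒵.seeds X ω z :=
      fun z hz => hS z (by rw [Walk.support_cons, List.tail_cons]; exact List.mem_of_mem_tail hz)
    have htail : ∀ e ∈ (S₁.concat h).edges, e ∈ (Walk.cons huw (S₁.concat h)).edges := fun e he => by
      rw [Walk.edges_cons]; exact List.mem_cons_of_mem _ he
    have ih := acc_iff_acc_of_segment S₁ h hS₁ (fun e he => hη e (htail e he))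
    -- the first edge of `S₁.concat h` contains `w`
    obtain ⟨f, hf, hwf⟩ : ∃ f ∈ (S₁.concat h).edges, w ∈ f :=
      exists_mem_edges_start _ (by rw [Walk.length_concat]; omega)
    have hfirst : 𝒵.Acc X ω s(u, w) ↔ 𝒵.Acc X ω f :=
      acc_iff_acc_of_shared hT hηX hηSQ ((mem_edgeSet (G := zdGraph 2)).2 huw) (hη _ (by simp))
        ((S₁.concat h).edges_subset_edgeSet hf) (hη _ (htail f hf)) (Sym2.mem_mk_right u w) hwf hwO
    intro e he e' he'
    rw [Walk.edges_cons, List.mem_cons] at he he'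
    rcases he with rfl | he <;> rcases he' with rfl | he'
    · rfl
    · exact hfirst.trans (ih f hf e' he')
    · exact (ih e he f hf).trans hfirst.symm
    · exact ih e he e' he'

end Junction

/-! ### Links and the chain decomposition -/

section Links

variable (𝒵) (X : Finset (Sym2 (Site 2))) (ω η : BondConfig (Site 2)) (U : Set (Site 2))

/-- **A link between two sites of `𝒪`** inside the region `U`: an `η`-open walk in `U` all of whose
edges are revealed (an edge of the graph `G`: connectivity in `ω̃|_M`) or all of whose edges are
accessible (an edge of `G*`: connectivity through the fresh region).
[cite: SchrammSmirnov2011, §4, proof of Prop. 4.1 (the graphs G and G*)] -/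
def Link (u v : Site 2) : Prop :=
  OReach 𝒵.seeds X ω u ∧ OReach 𝒵.seeds X ω v ∧
    ∃ W : (zdGraph 2).Walk u v, (∀ z ∈ W.support, z ∈ U) ∧ (∀ e ∈ W.edges, e ∈ η) ∧
      ((∀ e ∈ W.edges, ¬ 𝒵.Acc X ω e) ∨ (∀ e ∈ W.edges, 𝒵.Acc X ω e))

variable {𝒵 X ω η U}

/-- A chain of links is realised by an `η`-open walk inside `U`. [folklore] -/
theorem exists_walk_of_reflTransGen_link {u v : Site 2} (huv : ReflTransGen (𝒵.Link X ω η U) u v)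
    (hu : u ∈ U) :
    ∃ W : (zdGraph 2).Walk u v, (∀ z ∈ W.support, z ∈ U) ∧ ∀ e ∈ W.edges, e ∈ η := by
  induction huv with
  | refl => exact ⟨Walk.nil, by simp [hu], by simp⟩
  | @tail b c _ hbc ih =>
    obtain ⟨W, hWU, hWη⟩ := ih
    obtain ⟨-, -, W', hW'U, hW'η, -⟩ := hbc
    refine ⟨W.append W', fun z hz => ?_, fun e he => ?_⟩
    · rw [Walk.support_append, List.mem_append] at hz
      rcases hz with hz | hz
      · exact hWU z hz
      · exact hW'U z (List.mem_of_mem_tail hz)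
    · rw [Walk.edges_append, List.mem_append] at he
      exact he.elim (hWη e) (hW'η e)

variable (hT : IsTerminal 𝒵.seeds X ω) (hηX : ∀ e ∈ X, (e ∈ ω ↔ e ∈ η)) (hηSQ : ∀ e ∈ 𝒵.sqEdges, e ∉ η)
include hT hηX hηSQ

/-- A segment `S` from a site `u ∈ 𝒪` through non-`𝒪` sites, followed by a step onto a site
`a' ∈ 𝒪`, `η`-open and inside `U`, is a link from `u` to `a'`. [folklore] -/
theorem link_of_segment {u a a' : Site 2} (hu : OReach 𝒵.seeds X ω u) (ha' : OReach 𝒵.seeds X ω a')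
    (S : (zdGraph 2).Walk u a) (h : (zdGraph 2).Adj a a')
    (hS : ∀ z ∈ S.support.tail, ¬ OReach 𝒵.seeds X ω z) (hU : ∀ z ∈ (S.concat h).support, z ∈ U)
    (hη : ∀ e ∈ (S.concat h).edges, e ∈ η) : 𝒵.Link X ω η U u a' := by
  refine ⟨hu, ha', S.concat h, hU, hη, ?_⟩
  have key := acc_iff_acc_of_segment hT hηX hηSQ S h hS hη
  have hlast : s(a, a') ∈ (S.concat h).edges := by
    rw [Walk.edges_concat, List.concat_eq_append]; simp
  by_cases hacc : 𝒵.Acc X ω s(a, a')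
  · exact Or.inr fun e he => (key e he _ hlast).2 hacc
  · exact Or.inl fun e he h' => hacc ((key e he _ hlast).1 h')

/-- **Chain decomposition (inductive form).**  An `η`-open walk `W` inside `U` ending in `𝒪`,
preceded by a pending segment `S` from `u ∈ 𝒪` through non-`𝒪` sites, yields a chain of links from
`u` to the end of `W` (cut at every visit of `𝒪`). [cite: SchrammSmirnov2011, §4, proof of Prop. 4.1] -/
theorem reflTransGen_link_aux : ∀ {a v : Site 2} (W : (zdGraph 2).Walk a v),
    (∀ z ∈ W.support, z ∈ U) → (∀ e ∈ W.edges, e ∈ η) → OReach 𝒵.seeds X ω v →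
    ∀ {u : Site 2} (S : (zdGraph 2).Walk u a), OReach 𝒵.seeds X ω u →
      (∀ z ∈ S.support.tail, ¬ OReach 𝒵.seeds X ω z) → (∀ z ∈ S.support, z ∈ U) →
      (∀ e ∈ S.edges, e ∈ η) → ReflTransGen (𝒵.Link X ω η U) u v
  | a, _, Walk.nil, _, _, hv, u, S, hu, hS, _, _ => by
    cases S with
    | nil => exact ReflTransGen.refl
    | cons h S' => exact absurd hv (hS _ (by simp))
  | a, v, Walk.cons' _ b _ hab W', hWU, hWη, hv, u, S, hu, hS, hSU, hSη => by
    have hbU : b ∈ U := hWU b (by simp)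
    have hcatU : ∀ z ∈ (S.concat hab).support, z ∈ U := by
      intro z hz
      rw [Walk.support_concat, List.mem_append, List.mem_singleton] at hz
      rcases hz with hz | rfl
      · exact hSU z hz
      · exact hbU
    have hcatη : ∀ e ∈ (S.concat hab).edges, e ∈ η := by
      intro e he
      rw [Walk.edges_concat, List.concat_eq_append, List.mem_append, List.mem_singleton] at he
      rcases he with he | rfl
      · exact hSη e he
      · exact hWη _ (by simp)
    have hW'U : ∀ z ∈ W'.support, z ∈ U := fun z hz => hWU z (by simp [hz])
    have hW'η : ∀ e ∈ W'.edges, e ∈ η := fun e he => hWη e (by simp [he])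
    by_cases hb : OReach 𝒵.seeds X ω b
    · -- cut here: a link from `u` to `b`, then restart with the empty segment at `b`
      have hlink : 𝒵.Link X ω η U u b := link_of_segment hT hηX hηSQ hu hb S hab hS hcatU hcatη
      have hrest := reflTransGen_link_aux W' hW'U hW'η hv (Walk.nil : (zdGraph 2).Walk b b) hb
        (by simp) (by simp [hbU]) (by simp)
      exact ReflTransGen.head hlink hrest
    · -- extend the pending segment through the non-`𝒪` site `b`
      refine reflTransGen_link_aux W' hW'U hW'η hv (S.concat hab) hu (fun z hz => ?_) hcatU hcatη
      rw [Walk.support_concat, List.tail_append_of_ne_nil (Walk.support_ne_nil S),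
        List.mem_append, List.mem_singleton] at hz
      rcases hz with hz | rfl
      · exact hS z hz
      · exact hb

/-- **Structure theorem, walk form**: an `η`-open walk inside `U` between two sites of `𝒪` is a
chain of links (edges of `G ∪ G*`). [cite: SchrammSmirnov2011, §4, proof of Prop. 4.1 ("ω̃ ∈ ⊞_{Q₀} iff there is a path … in G ∪ G*")] -/
theorem reflTransGen_link_of_walk {u v : Site 2} (hu : OReach 𝒵.seeds X ω u) (hv : OReach 𝒵.seeds X ω v)
    (W : (zdGraph 2).Walk u v) (hWU : ∀ z ∈ W.support, z ∈ U) (hWη : ∀ e ∈ W.edges, e ∈ η) :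
    ReflTransGen (𝒵.Link X ω η U) u v :=
  reflTransGen_link_aux hT hηX hηSQ W hWU hWη hv Walk.nil hu (by simp) (by simp [hWU u (by simp)])
    (by simp)

/-- **Structure theorem**: for sites `u, v ∈ 𝒪` of the region `U`, there is an `η`-open walk from
`u` to `v` inside `U` iff `u` and `v` are joined by a chain of links.
[cite: SchrammSmirnov2011, §4, proof of Prop. 4.1 ("ω̃ ∈ ⊞_{Q₀} iff there is a path … in G ∪ G*")] -/
theorem exists_walk_iff_reflTransGen_link {u v : Site 2} (hu : OReach 𝒵.seeds X ω u)
    (hv : OReach 𝒵.seeds X ω v) (huU : u ∈ U) :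
    (∃ W : (zdGraph 2).Walk u v, (∀ z ∈ W.support, z ∈ U) ∧ ∀ e ∈ W.edges, e ∈ η) ↔
      ReflTransGen (𝒵.Link X ω η U) u v :=
  ⟨fun ⟨W, hWU, hWη⟩ => reflTransGen_link_of_walk hT hηX hηSQ hu hv W hWU hWη,
    fun h => exists_walk_of_reflTransGen_link h huU⟩

/-- **Structure theorem, crossing form**: for sets `S₀, S₂` of sites of `𝒪` inside `U`, an
`η`-open crossing of `U` from `S₀` to `S₂` exists iff some site of `S₀` is joined to some site of
`S₂` by a chain of links. [cite: SchrammSmirnov2011, §4, proof of Prop. 4.1 ("ω̃ ∈ ⊞_{Q₀} iff there is a path from ∂₀Q₀ to ∂₂Q₀ in G ∪ G*")] -/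
theorem exists_crossing_iff_reflTransGen_link {S₀ S₂ : Set (Site 2)}
    (hS₀ : ∀ s ∈ S₀, OReach 𝒵.seeds X ω s ∧ s ∈ U) (hS₂ : ∀ s ∈ S₂, OReach 𝒵.seeds X ω s) :
    (∃ u ∈ S₀, ∃ v ∈ S₂, ∃ W : (zdGraph 2).Walk u v, (∀ z ∈ W.support, z ∈ U) ∧ ∀ e ∈ W.edges, e ∈ η) ↔
      ∃ u ∈ S₀, ∃ v ∈ S₂, ReflTransGen (𝒵.Link X ω η U) u v := by
  refine exists_congr fun u => and_congr_right fun hu => exists_congr fun v => and_congr_right fun hv => ?_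
  exact exists_walk_iff_reflTransGen_link hT hηX hηSQ (hS₀ u hu).1 (hS₂ v hv) (hS₀ u hu).2

end Links

/-! ### The revealed set is a stopping set -/

section Revealed

variable (𝒵) (G₀ : Finset (Sym2 (Site 2)))

/-- **The revealed edges** of `ω` in the window `G₀`: those not in the accessible fresh region of
the terminal exploration data of `ω` (examined edges, far edges, square edges, and the pockets).
[cite: SchrammSmirnov2011, §4, proof of Prop. 4.1 (the set M = the complement of M')] -/
def revealed (ω : BondConfig (Site 2)) : Finset (Sym2 (Site 2)) :=
  G₀.filter fun e => ¬ 𝒵.Acc (examined 𝒵.seeds ω) ω e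

variable {𝒵 G₀}

/-- Membership in the revealed edges. [folklore] -/
theorem mem_revealed_iff {ω : BondConfig (Site 2)} {e : Sym2 (Site 2)} :
    e ∈ 𝒵.revealed G₀ ω ↔ e ∈ G₀ ∧ ¬ 𝒵.Acc (examined 𝒵.seeds ω) ω e := by
  rw [revealed, Finset.mem_filter]

/-- The revealed edges lie in the window. [folklore] -/
theorem revealed_subset (ω : BondConfig (Site 2)) : 𝒵.revealed G₀ ω ⊆ G₀ := Finset.filter_subset _ _

/-- **Examined edges are revealed** (accessible edges are fresh, hence unexamined).
[cite: SchrammSmirnov2011, §4, proof of Prop. 4.1] -/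
theorem examined_subset_revealed (hG₀ : 𝒵.collar.A ⊆ G₀) (ω : BondConfig (Site 2)) :
    examined 𝒵.seeds ω ⊆ 𝒵.revealed G₀ ω := by
  intro e he
  have heA : e ∈ 𝒵.collar.A := examined_subset ω he
  refine mem_revealed_iff.2 ⟨hG₀ heA, fun hacc => ?_⟩
  exact 𝒵.not_mem_of_mem_fresh (examined_subset ω) hacc.mem_fresh he

/-- **The unrevealed edges of the window are exactly the accessible ones** (when the window contains
every examinable and every tube edge). [folklore] -/
theorem mem_sdiff_revealed_iff (hG₀ : 𝒵.collar.A ⊆ G₀) (hG₀' : 𝒵.tubeEdges ⊆ G₀) {ω : BondConfig (Site 2)}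
    {e : Sym2 (Site 2)} : e ∈ G₀ \ 𝒵.revealed G₀ ω ↔ 𝒵.Acc (examined 𝒵.seeds ω) ω e := by
  rw [Finset.mem_sdiff, mem_revealed_iff]
  constructor
  · rintro ⟨hG, h⟩
    by_contra hacc
    exact h ⟨hG, hacc⟩
  · intro hacc
    have hG : e ∈ G₀ := by
      rcases 𝒵.mem_fresh_iff.1 hacc.mem_fresh with h | h
      · exact hG₀ h.1
      · exact hG₀' h
    exact ⟨hG, fun h => h.2 hacc⟩

/-- **The revealed set is a stopping set**: configurations agreeing on the revealed edges of `ω`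
agree on its examined edges, hence have the same terminal data, the same `𝒪`, the same accessible
region. [cite: SchrammSmirnov2011, §4, proof of Prop. 4.1 ("This follows directly from the fact that M(ω₂) = M(ω)")] -/
theorem isStoppingSet_revealed (hG₀ : 𝒵.collar.A ⊆ G₀) : IsStoppingSet (𝒵.revealed G₀) := by
  intro ω ω' hag
  have hagX : ∀ e ∈ examined 𝒵.seeds ω, (e ∈ ω ↔ e ∈ ω') :=
    fun e he => hag e (examined_subset_revealed hG₀ ω he)
  have hX : examined 𝒵.seeds ω' = examined 𝒵.seeds ω := isStoppingSet_examined ω ω' hagX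
  ext e
  rw [mem_revealed_iff, mem_revealed_iff, hX, acc_congr (ω := ω) (ω' := ω') hagX]

end Revealed

end Zones

end Seeded

end Literature.Probability.Percolation
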